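import Summits.CriticalPhenomena.PercolationContinuityZ3.Theses.PercTreeValue
import Literature.Probability.Percolation.ClusterBoundary
import Literature.Probability.Percolation.FiniteEnergy
import Literature.Probability.Percolation.BondPercolationSymmetry
import Literature.Probability.Percolation.BKFinitary

/-!
# Sketch — crux-ideate stmt-CriticalPhenomena-7798 (TetrahedronDisjointCoexistence), ideator 2, round 1

First-lemma signatures for the idea cards `confinement-squaring` and `halfspace-roof-avoidance`.
Nothing here is an item; `sorry` marks statements to be proved by a line, the point is that they
ELABORATE over existing declarations.
-/

noncomputable section

namespace Summit.CriticalPhenomena.PercolationContinuityZ3.Cruxes.TetrahedronDisjointCoexistence.SketchIdeator2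

open MeasureTheory Literature.Probability.Percolation Literature.Probability.LatticeModels
open scoped ENNReal

/-- The critical bond measure on `ℤ³`. -/
abbrev P3 : Measure (BondConfig (Site 3)) := bondPercolation (zdGraph 3) (criticalProbI 3)

/-- Vertices of the lattice tetrahedron `T_r`. -/
def aR (r : ℕ) : Site 3 := ![(r : ℤ), (r : ℤ), 0]
def bR (r : ℕ) : Site 3 := ![(r : ℤ), 0, (r : ℤ)]
def cR (r : ℕ) : Site 3 := ![0, (r : ℤ), (r : ℤ)]

/-- The disjoint-coexistence event and probability `D_r = P(0↔a_r, b_r↔c_r, 0↮b_r)`. -/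
def Devent (r : ℕ) : Set (BondConfig (Site 3)) :=
  openConn 0 (aR r) ∩ openConn (bR r) (cR r) ∩ (openConn (0 : Site 3) (bR r))ᶜ
def Dr (r : ℕ) : ℝ := P3.real (Devent r)

/-- The crux, restated through `Dr` (definitionally the route decl up to unfolding `aR bR cR`). -/
theorem crux_iff : Theses.PercTreeValue.TetrahedronDisjointCoexistence ↔
    ∃ δ : ℝ, 0 < δ ∧ ∃ r₀ : ℕ, ∀ r : ℕ, r₀ ≤ r →
      δ * tau 3 (criticalProbI 3) 0 (aR r) * tau 3 (criticalProbI 3) (bR r) (cR r) ≤ Dr r := Iff.rfl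

/-! ## Card 1 — confinement squaring -/

/-- Confinement event: `y ∈ C(x)` and the WHOLE cluster of `x` lies inside `R`. -/
def confEvent (R : Set (Site 3)) (x y : Site 3) : Set (BondConfig (Site 3)) :=
  {ω | y ∈ openCluster ω x ∧ openCluster ω x ⊆ R}

/-- (L0, Markov lower bound — provable now from `real_clusterIs_inter_offConn`,
`pairwise_disjoint_clusterIs`, and the pointwise inclusion
`{K_0 = S} ∩ {b ↔ c off S} ⊆ D` for `a ∈ S`, `b, c ∉ S`.)
`D_r ≥ Σ_S 𝟙{a_r ∈ S, b_r, c_r ∉ S} · P(K_0 = S) · P(b_r ↔ c_r off S)`. -/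
theorem first_lemma_markov (r : ℕ) :
    ∑' S : Finset (Site 3),
      (if aR r ∈ S ∧ bR r ∉ S ∧ cR r ∉ S then
        P3.real (clusterIs (0 : Site 3) S) * P3.real (openConnIn ((↑S : Set (Site 3))ᶜ) (bR r) (cR r))
       else 0) ≤ Dr r := by
  sorry

/-- (L1, squaring — provable now.) If the LATTICE-edge supports of `R₁` and `R₂` are disjoint then
the two confinement events are independent (`bondPercolation_real_inter_of_disjoint`; the events are
determined by `edgesTouching Rᵢ` as in `determinedBy_clusterIs`, and a.s. `ω ⊆ edgeSet`,
`setBernoulli_ae_subset`, lets one restrict the supports to lattice edges) and their intersection lies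
in `D_r` (on it `C(0) ⊆ R₁`, `C(b) ⊆ R₂`, and `R₁ ∩ R₂` contains no vertex of positive degree... in
fact `C(0) = C(b)` would give a vertex `v ∈ R₁ ∩ R₂` on an open lattice path, whose edge touches both). -/
theorem first_lemma_confine_product (r : ℕ) (R₁ R₂ : Set (Site 3))
    (hdisj : Disjoint (edgesTouching R₁ ∩ (zdGraph 3).edgeSet) (edgesTouching R₂ ∩ (zdGraph 3).edgeSet)) :
    P3.real (confEvent R₁ 0 (aR r)) * P3.real (confEvent R₂ (bR r) (cR r)) ≤ Dr r := by
  sorry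

/-- The edge-swapping lattice automorphism of `T_r`: `φ(x) = (r - x₁, x₀, r - x₂)`, a signed
coordinate permutation followed by a translation; `φ 0 = b_r`, `φ a_r = c_r`, `φ b_r = a_r`,
`φ c_r = 0` (order 4, a rotoreflection of the regular tetrahedron). -/
def phi (r : ℕ) (x : Site 3) : Site 3 := ![(r : ℤ) - x 1, x 0, (r : ℤ) - x 2]

theorem phi_zero (r : ℕ) : phi r 0 = bR r := by
  ext i; fin_cases i <;> simp [phi, bR]
theorem phi_a (r : ℕ) : phi r (aR r) = cR r := by
  ext i; fin_cases i <;> simp [phi, aR, cR]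

/-- (L2, symmetry — provable now from `bondPercolation_real_preimage_relabel_iso` once `phi r` is
packaged as `zdGraph 3 ≃g zdGraph 3`.) -/
theorem first_lemma_confine_symm (r : ℕ) (R : Set (Site 3)) :
    P3.real (confEvent (phi r '' R) (bR r) (cR r)) = P3.real (confEvent R 0 (aR r)) := by
  sorry

/-- The lower half-space `{x₂ ≤ (r-2)/2}`; its `φ`-image is `{x₂ ≥ (r+2)/2}` and the two edge
supports are disjoint (one empty layer for even `r`, two for odd `r`). -/
def lowerHalf (r : ℕ) : Set (Site 3) := {x | 2 * x 2 + 2 ≤ (r : ℤ)}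

theorem lowerHalf_edges_disjoint (r : ℕ) :
    Disjoint (edgesTouching (lowerHalf r) ∩ (zdGraph 3).edgeSet)
      (edgesTouching (phi r '' lowerHalf r) ∩ (zdGraph 3).edgeSet) := by
  rw [Set.disjoint_left]
  intro e he1 he2
  obtain ⟨⟨v, hve, hv⟩, he⟩ := he1
  obtain ⟨⟨w, hwe, hw⟩, -⟩ := he2
  obtain ⟨y, hy, rfl⟩ := hw
  simp only [lowerHalf, Set.mem_setOf_eq] at hv hy
  have hphi : phi r y 2 = (r : ℤ) - y 2 := by simp [phi]
  have key : phi r y 2 - v 2 ≤ 1 := by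
    induction e using Sym2.ind with
    | h x x' =>
      rw [SimpleGraph.mem_edgeSet] at he
      rw [Sym2.mem_iff] at hve hwe
      have hxx' : ∀ i, x' i - x i ≤ 1 ∧ x i - x' i ≤ 1 := by
        intro i
        obtain ⟨j, h | h⟩ := (zdGraph_adj_iff x x').1 he
        · rw [h]
          by_cases hij : i = j
          · subst hij; simp
          · simp [hij]
        · rw [h]
          by_cases hij : i = j
          · subst hij; simp
          · simp [hij]
      have h2 := hxx' 2
      rcases hve with h1 | h1 <;> rcases hwe with h3 | h3 <;> rw [h1, h3] <;> omega
  omega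

/-- TRANSFER `C⁺` (one-cluster statement): CONFINEMENT POSITIVITY — the critical cluster of `0`,
conditioned on containing `a_r = (r,r,0)`, lies below height `r/2 - 1` with probability bounded
away from `0`, uniformly in `r`. -/
def ConfinementPositivity : Prop :=
  ∃ c : ℝ, 0 < c ∧ ∃ r₀ : ℕ, ∀ r : ℕ, r₀ ≤ r →
    c * tau 3 (criticalProbI 3) 0 (aR r) ≤ P3.real (confEvent (lowerHalf r) 0 (aR r))

/-- `τ(b_r, c_r) = τ(0, a_r)` (translation by `b_r` and a coordinate symmetry;
`bondPercolation_real_preimage_relabel_iso`). -/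
theorem tau_bc_eq (r : ℕ) : tau 3 (criticalProbI 3) (bR r) (cR r) = tau 3 (criticalProbI 3) 0 (aR r) := by
  sorry

/-- Composition (PROVED modulo L1, L2, `tau_bc_eq`; uses the proved `lowerHalf_edges_disjoint`):
`ConfinementPositivity → crux` with `δ = c²`. -/
theorem crux_of_confinement : ConfinementPositivity → Theses.PercTreeValue.TetrahedronDisjointCoexistence := by
  rintro ⟨c, hc, r₀, h⟩
  rw [crux_iff]
  refine ⟨c ^ 2, by positivity, r₀, fun r hr => ?_⟩
  have h1 := h r hr
  have hsq := first_lemma_confine_product r (lowerHalf r) (phi r '' lowerHalf r) (lowerHalf_edges_disjoint r)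
  rw [first_lemma_confine_symm] at hsq
  rw [tau_bc_eq]
  have hτ : 0 ≤ tau 3 (criticalProbI 3) 0 (aR r) := tau_nonneg _ _ _
  calc c ^ 2 * tau 3 (criticalProbI 3) 0 (aR r) * tau 3 (criticalProbI 3) 0 (aR r)
        = (c * tau 3 (criticalProbI 3) 0 (aR r)) * (c * tau 3 (criticalProbI 3) 0 (aR r)) := by ring
    _ ≤ P3.real (confEvent (lowerHalf r) 0 (aR r)) * P3.real (confEvent (lowerHalf r) 0 (aR r)) :=
        mul_le_mul h1 h1 (by positivity) measureReal_nonneg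
    _ ≤ Dr r := hsq

/-- The maximal admissible region (Voronoi cell of the edge `{0, a_r}` against `{b_r, c_r}`, with a
collar): `Δ(x) = min(|x-b|², |x-c|²) - min(|x|², |x-a|²) ≥ m`; `φ` maps `{Δ ≥ m}` onto `{Δ ≤ -m}`. -/
def sqd (x y : Site 3) : ℤ := ∑ i, (x i - y i) ^ 2
def voronoiCell (r m : ℕ) : Set (Site 3) :=
  {x | (m : ℤ) + min (sqd x 0) (sqd x (aR r)) ≤ min (sqd x (bR r)) (sqd x (cR r))}

/-- Weakest confinement hypothesis of this shape (collar `m = 6r+4` makes the edge supports of the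
cell and of its `φ`-image disjoint). -/
def VoronoiConfinementPositivity : Prop :=
  ∃ c : ℝ, 0 < c ∧ ∃ r₀ : ℕ, ∀ r : ℕ, r₀ ≤ r →
    c * tau 3 (criticalProbI 3) 0 (aR r) ≤ P3.real (confEvent (voronoiCell r (6 * r + 4)) 0 (aR r))

/-! ### Two replicas: non-intersection of independent conditioned clusters (the level above confinement) -/

/-- Pairs of independent configurations: `a_r ∈ C₁(0)`, `c_r ∈ C₂(b_r)` with `C₂(b_r)` finite, and the two clusters
(from DIFFERENT configurations) vertex-disjoint. -/
def TwoReplicaDisjoint (r : ℕ) : Set (BondConfig (Site 3) × BondConfig (Site 3)) :=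
  {q | aR r ∈ openCluster q.1 0 ∧ cR r ∈ openCluster q.2 (bR r) ∧ (openCluster q.2 (bR r)).Finite ∧
       Disjoint (openCluster q.1 0) (openCluster q.2 (bR r))}

/-- (L0', cluster-gas / two-replica bound — provable now through `first_lemma_markov` with the roles of the two
edges exchanged: explore the finite cluster `C₂(b) = S` in the second factor, `P(K_b = S) · P(0 ↔ a, C(0) ∩ S = ∅)
≤ P(K_b = S) · P(0 ↔ a off S)`, and resum inside ONE configuration by the Markov property.)
Exact form (not needed): `D_r = E⊗E[1_A 1_B 1{C₁∩C₂=∅} (1-p)^{-N(C₁,C₂)}]`, `N` = lattice edges between the clusters. -/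
theorem first_lemma_two_replica (r : ℕ) : (P3.prod P3).real (TwoReplicaDisjoint r) ≤ Dr r := by
  sorry

/-- TRANSFER (strongest data-backed form): NON-INTERSECTION POSITIVITY of two independent conditioned clusters,
`P⊗P(C₁(0) ∩ C₂(b_r) = ∅ | 0 ↔₁ a_r, b_r ↔₂ c_r) ≥ q > 0`. Confinement squaring is its sub-case
`{C₁ ⊆ R₁} × {C₂ ⊆ φ R₁}`. -/
def TwoReplicaNonIntersection : Prop :=
  ∃ q : ℝ, 0 < q ∧ ∃ r₀ : ℕ, ∀ r : ℕ, r₀ ≤ r →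
    q * tau 3 (criticalProbI 3) 0 (aR r) * tau 3 (criticalProbI 3) (bR r) (cR r) ≤ (P3.prod P3).real (TwoReplicaDisjoint r)

theorem crux_of_two_replica : TwoReplicaNonIntersection → Theses.PercTreeValue.TetrahedronDisjointCoexistence := by
  rintro ⟨q, hq, r₀, h⟩
  rw [crux_iff]
  exact ⟨q, hq, r₀, fun r hr => (h r hr).trans (first_lemma_two_replica r)⟩

theorem two_replica_of_confinement : ConfinementPositivity → TwoReplicaNonIntersection := by
  sorry

/-! ## Card 2 — half-space roof avoidance -/

/-- The roof layer of `lowerHalf r`: `{2 x₂ + 2 = r ∨ 2 x₂ + 3 = r}` i.e. the top layer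
`x₂ = ⌊(r-2)/2⌋`. -/
def roofLayer (r : ℕ) : Set (Site 3) := {x | x ∈ lowerHalf r ∧ ∀ y ∈ lowerHalf r, y 2 ≤ x 2}

/-- `x ↔ roof inside the lower half-space`. -/
def toRoof (r : ℕ) (x : Site 3) : Set (BondConfig (Site 3)) :=
  ⋃ y ∈ roofLayer r, openConnIn (lowerHalf r) x y

/-- (L3, provable now by `bk_finitary`): restriction costs at most the square of the half-space
one-arm probability — `τ(0,a_r) - P(0 ↔ a_r in H) ≤ P(0 ↔_H roof) · P(a_r ↔_H roof)`:
on `{0↔a} \ {0 ↔_H a}` an open path leaves `H`; its initial and final segments are witnesses in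
the two DIFFERENT `H`-clusters of `0` and `a_r`, hence disjointly occurring. -/
theorem first_lemma_halfspace_bk (r : ℕ) (hr : 2 ≤ r) :
    tau 3 (criticalProbI 3) 0 (aR r) - P3.real (openConnIn (lowerHalf r) 0 (aR r)) ≤
      P3.real (toRoof r 0) * P3.real (toRoof r (aR r)) := by
  sorry

/-- Pointwise identity behind (Conf) = (Res) ∧ (NoRoof): the cluster of `0` lies in `H` and contains
`a` iff `0 ↔ a` inside `H` and `0` is NOT joined to the roof layer inside `H`... up to the vertical
edges leaving the roof: precisely `confEvent H 0 a = openConnIn H 0 a ∩ {no open edge from C_H(0) out of H}`,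
and `{0 ↮_H roof} ∩ openConnIn H 0 a ⊆ confEvent H 0 a`. -/
theorem conf_of_conn_not_toRoof (r : ℕ) :
    {ω | ω ⊆ (zdGraph 3).edgeSet} ∩ openConnIn (lowerHalf r) 0 (aR r) ∩ (toRoof r 0)ᶜ ⊆
      confEvent (lowerHalf r) 0 (aR r) := by
  -- pointwise only for configurations supported on lattice edges (an a.s. event,
  -- `setBernoulli_ae_subset`): a non-lattice pair in ω could let C(0) jump out of H without
  -- touching the roof layer.  S' := H-cluster of 0 is closed under open lattice edges unless the
  -- roof is hit, then `walk_end_mem_of_closed`.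
  rintro ω ⟨⟨hωE, hconn⟩, hroof⟩
  set H := lowerHalf r with hH
  set S' : Set (Site 3) := {v | ω ∈ openConnIn H 0 v} with hS'
  have hcl : ∀ a ∈ S', ∀ b, s(a, b) ∈ ω → a ≠ b → b ∈ S' := by
    intro a ha b hab hne
    obtain ⟨h0, haH, hreach⟩ := ha
    have hadj : (zdGraph 3).Adj a b := (SimpleGraph.mem_edgeSet _).1 (hωE hab)
    by_cases hbH : b ∈ H
    · refine ⟨h0, hbH, hreach.trans (SimpleGraph.Adj.reachable ?_)⟩
      show (openGraph ω).Adj a b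
      exact (openGraph_adj ω a b).2 ⟨hab, hne⟩
    · exfalso
      apply hroof
      simp only [toRoof, Set.mem_iUnion]
      refine ⟨a, ⟨haH, fun y hy => ?_⟩, h0, haH, hreach⟩
      have hab2 : b 2 - a 2 ≤ 1 := by
        obtain ⟨j, h | h⟩ := (zdGraph_adj_iff a b).1 hadj
        · rw [h]
          by_cases hj : (2 : Fin 3) = j
          · subst hj; simp
          · simp [hj]
        · rw [h]
          by_cases hj : (2 : Fin 3) = j
          · subst hj; simp
          · simp [hj]
      simp only [hH, lowerHalf, Set.mem_setOf_eq] at haH hbH hy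
      omega
  have h0S : (0 : Site 3) ∈ S' := by
    obtain ⟨h0, -, -⟩ := hconn
    exact ⟨h0, h0, SimpleGraph.Reachable.refl _⟩
  refine ⟨?_, fun z hz => ?_⟩
  · obtain ⟨h0, ha, hreach⟩ := hconn
    exact hreach.map (SimpleGraph.Embedding.induce H).toHom
  · have hz' : (openGraph ω).Reachable 0 z := hz
    obtain ⟨w⟩ := hz'
    obtain ⟨-, hzH, -⟩ := walk_end_mem_of_closed hcl w h0S z w.end_mem_support
    exact hzH

/-- (Res) restriction positivity and (NoRoof) roof avoidance, the two halves of (Conf). -/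
def RestrictionPositivity : Prop :=
  ∃ c : ℝ, 0 < c ∧ ∃ r₀ : ℕ, ∀ r : ℕ, r₀ ≤ r →
    c * tau 3 (criticalProbI 3) 0 (aR r) ≤ P3.real (openConnIn (lowerHalf r) 0 (aR r))

def RoofAvoidance : Prop :=
  ∃ c : ℝ, 0 < c ∧ ∃ r₀ : ℕ, ∀ r : ℕ, r₀ ≤ r →
    c * P3.real (openConnIn (lowerHalf r) 0 (aR r)) ≤
      P3.real (openConnIn (lowerHalf r) 0 (aR r) ∩ (toRoof r 0)ᶜ)

/-- A sufficient condition for (Res) through L3: the two-point function at distance `r√2` beats the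
square of the half-space one-arm probability from depth `r/2` by a factor. -/
def TwoPointBeatsArmSquared : Prop :=
  ∃ c : ℝ, 0 < c ∧ ∃ r₀ : ℕ, ∀ r : ℕ, r₀ ≤ r →
    (1 + c) * (P3.real (toRoof r 0) * P3.real (toRoof r (aR r))) ≤ tau 3 (criticalProbI 3) 0 (aR r)

theorem restriction_of_beats : TwoPointBeatsArmSquared → RestrictionPositivity := by
  sorry

theorem confinement_of_res_noRoof : RestrictionPositivity → RoofAvoidance → ConfinementPositivity := by
  sorry

/-! ## Card 3 — bridge–seam switching (the merged side) -/

/-- The merged event `M = {0 ↔ a_r ↔ b_r ↔ c_r}`. -/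
def Mevent (r : ℕ) : Set (BondConfig (Site 3)) :=
  openConn 0 (aR r) ∩ openConn (0 : Site 3) (bR r) ∩ openConn (0 : Site 3) (cR r)

/-- The SEAM: lattice edges joining the cluster of `0` to the cluster of `b_r` (all closed when the
clusters differ); its size is the contact number `N`. -/
def seam (r : ℕ) (ω : BondConfig (Site 3)) : Set (Sym2 (Site 3)) :=
  {e | e ∈ (zdGraph 3).edgeSet ∧ ∃ u v : Site 3, e = s(u, v) ∧ u ∈ openCluster ω 0 ∧ v ∈ openCluster ω (bR r)}

/-- Contact number `N(ω) = |seam|` (as `ℝ≥0∞` through `encard`). -/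
def contactCount (r : ℕ) (ω : BondConfig (Site 3)) : ℝ≥0∞ := ((seam r ω).encard : ℝ≥0∞)

/-- (L4, single-edge SWITCHING — provable now from independence of `{e open}` and the σ-algebra of
the other edges, `bondPercolation_real_inter_of_disjoint` twice): opening a contact edge of a
`D`-configuration gives an `M`-configuration in which that edge is a separating bridge, and the
measure changes by the factor `p/(1-p)`.  Summing over `e`: `E[R ; M] = (p/(1-p)) · E[N ; D]`
(`R` = number of open edges whose closure turns `M` into `D`). -/
theorem first_lemma_switch (r : ℕ) (e : Sym2 (Site 3)) (he : e ∈ (zdGraph 3).edgeSet) :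
    (1 - (criticalProbI 3 : ℝ)) * P3.real {ω | e ∈ ω ∧ ω ∈ Mevent r ∧ ω \ {e} ∈ Devent r} =
      (criticalProbI 3 : ℝ) * P3.real {ω | e ∉ ω ∧ insert e ω ∈ Mevent r ∧ ω ∈ Devent r} := by
  sorry

/-- Pointwise heart of the switching: a contact edge, once inserted, merges (and conversely). -/
theorem insert_mem_Mevent_of_seam (r : ℕ) {ω : BondConfig (Site 3)} (hω : ω ∈ Devent r)
    {e : Sym2 (Site 3)} (he : e ∈ seam r ω) : insert e ω ∈ Mevent r := by
  sorry

/-- TRANSFER (merged side): SEAM CAUCHY–SCHWARZ — the contact number restricted to `D` has second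
moment at most `C/ττ` times the square of its first moment (equivalently, by the two switching
identities, "minimal separating 2-cuts of the merged cluster ≲ (bridges)²": a statement about the
cut structure of ONE merged cluster).  By Cauchy–Schwarz `D ≥ E[N;D]²/E[N²;D] ≥ ττ/C`. -/
def SeamCauchySchwarz : Prop :=
  ∃ C : ℝ≥0∞, C ≠ ⊤ ∧ ∃ r₀ : ℕ, ∀ r : ℕ, r₀ ≤ r →
    (∫⁻ ω in Devent r, contactCount r ω ^ 2 ∂P3) *
        ENNReal.ofReal (tau 3 (criticalProbI 3) 0 (aR r) * tau 3 (criticalProbI 3) (bR r) (cR r)) ≤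
      C * (∫⁻ ω in Devent r, contactCount r ω ∂P3) ^ 2

/-- `SeamCauchySchwarz → crux` (Cauchy–Schwarz in `L²(P3|_D)`; the first moment is finite and
positive for large `r` — positivity from `D_r > 0`, which holds at every `r ≥ 1` by finite energy). -/
theorem crux_of_seamCS : SeamCauchySchwarz → Theses.PercTreeValue.TetrahedronDisjointCoexistence := by
  sorry

end Summit.CriticalPhenomena.PercolationContinuityZ3.Cruxes.TetrahedronDisjointCoexistence.SketchIdeator2

end
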